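import Summits.BirchSwinnertonDyer.Rank1Residual.X2.NonPrimitiveLambdaInvariantSplitOfDatum
import Literature.NumberTheory.EllipticCurves.GreenbergVatsal2000.TrivialZeroInfiniteIndex
import HarnessLib

/-!
# GV (5)–(7) at an odd prime `p ‖ N` DERIVED: the record
# `GreenbergVatsal2000.lambda_nonPrimitive_eq_add_sum_delta_multiplicative` (registry A133) is a
# COROLLARY of the datum record (T-GV23L), the Tate uniformisations (A40, A41) and the trivial-zero
# record `datumStrictSelmer_relIndex_eq_zero_of_split` (A137')

HONEST FRAMING (BSD rank-`≤ 1` residual cell `b2b-bsdres`, home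
`run/shared/lean/b2b/bsd-rank1-residual/`, unit `b2b-bsdres-eisenstein-p2`, class X2; research route,
no claim beyond stated classes): the cell deletes the COMBINATION-SHAPED residual classes of the
rank-`≤ 1` BSD formula from PUBLISHED theorems only and TYPES the construction-shaped ones; this is
not "finishing BSD". THEOREMS ONLY (no definition, no named fact, nothing asserted).

## What

Greenberg–Vatsal only sketch the multiplicative case of their (5)–(7) (pp. 14–15, Remark (2.10));
the cell recorded it as the named fact `lambda_nonPrimitive_eq_add_sum_delta_multiplicative` (A133,
once flagged `GV00-mult-asserted`). With GV's §2 statements now recorded at the DATUM level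
(`datumSelmer_nonPrimitive_invariants`: Prop. (2.1) ⇒ Cor. (2.3) + Prop. (2.4), any line `C`), the
multiplicative case is ASSEMBLED here in the kernel from printed pieces:

* NON-SPLIT `p`: the classical groups ARE the datum groups of the twisted Tate datum (no trivial
  zero) — `NonPrimitiveLambdaInvariantMultiplicativeOfDatum` (A41);
* SPLIT `p`: the classical groups are the STRICT datum groups; the duals differ from the datum duals
  by the dual of the trivial-zero quotient `S_A/S^{str}_A ↪ ℚ_p/ℤ_p`, of corank `1` on both the
  primitive and the non-primitive side as soon as `S_A/S^{str}_A` is infinite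
  (`NonPrimitiveLambdaInvariantSplitOfDatum`, A40) — which is GV p. 15 / Prop. (2.1) p. 20, the record
  `datumStrictSelmer_relIndex_eq_zero_of_split` (A137'), applied to the canonical dual of `S_A(ℚ_∞)`
  (finitely generated and torsion by `moduleFinite_and_isTorsion_datumDualData_empty_of_split`).

* `lambda_nonPrimitive_eq_add_sum_delta_multiplicative_of_datum :
    datumSelmer_nonPrimitive_invariants → Silverman1994_thmV53_tateUniformisation →
    Silverman1994_thmV53_corV54_tateUniformisation → datumStrictSelmer_relIndex_eq_zero_of_split →
    lambda_nonPrimitive_eq_add_sum_delta_multiplicative`.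

Registry consequence (for lit / the referee, not asserted by Lean): A133 is DERIVED modulo
{T-GV23L, A40, A41, A137'}; every consumer of `(hA : lambda_nonPrimitive_eq_add_sum_delta_multiplicative)`
(the X2a closure `ClassClosureOfDerivedF0`, `GreenbergSelmerCount*`, `NonPrimitiveSelmerCorank`,
routes G/T) can be fed from these records, all of which except A137' it already holds.

References: GV 2000 = arXiv:math/9906215 §1 (5)–(7) pp. 7–8, pp. 14–15, §2 pp. 16–22, 26, Remark
(2.10); Silverman ATAEC V.3.1, V.5.3, V.5.4; Greenberg LNM 1716 §1 p. 60, §2 p. 76, p. 93.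
-/

noncomputable section

open scoped Classical AddSubgroup

namespace Summit.BirchSwinnertonDyer.Rank1Residual.X2.NonPrimitiveLambdaInvariantMultiplicativeDerived

open NumberField IsDedekindDomain Field WeierstrassCurve
  Literature.NumberTheory.EllipticCurves Literature.NumberTheory.EllipticCurves.GreenbergSelmer
  Literature.NumberTheory.EllipticCurves.GreenbergVatsal2000
  Literature.NumberTheory.GaloisRepresentations
  Summit.BirchSwinnertonDyer.Rank1Residual.X2.GreenbergVatsalTorsion
  Summit.BirchSwinnertonDyer.Rank1Residual.X2.GreenbergVatsalStrictSelmer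
  Summit.BirchSwinnertonDyer.Rank1Residual.X2.GreenbergVatsalTateDatumCofree
  Summit.BirchSwinnertonDyer.Rank1Residual.X2.NonPrimitiveLambdaInvariantMultiplicativeOfDatum
  Summit.BirchSwinnertonDyer.Rank1Residual.X2.NonPrimitiveLambdaInvariantSplitOfDatum

/-- **GV (6)–(7) at an odd SPLIT `p ‖ N`, DERIVED** — the conclusion of A133 at a prime of split
multiplicative reduction from the datum record (`h23`), the untwisted Tate uniformisation (`hT`,
A40: the Tate data of `exists_data_of_split`, `E(ℚ_∞)[p^∞]` finite) and the trivial-zero record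
(`hInf`, A137': `S_A(ℚ_∞)/S^{str}_A(ℚ_∞)` infinite, applied to the canonical dual of `S_A(ℚ_∞)`,
which is finitely generated and torsion because `X(E/ℚ_∞)` is).
[cite: GreenbergVatsal2000, §1 (5)–(7) pp. 7–8; pp. 14–15; §2 Prop. (2.1) p. 20, Cor. (2.3), Prop. (2.4), p. 26]
[cite: SilvermanATAEC1994, Ch. V Thm. 3.1 (c),(d) p. 423 and §V.5 Thm. 5.3 (a),(b)] -/
theorem invariants_multiplicative_of_split (h23 : datumSelmer_nonPrimitive_invariants)
    (hT : Silverman1994_thmV53_tateUniformisation.{0})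
    (hInf : datumStrictSelmer_relIndex_eq_zero_of_split)
    (W : WeierstrassCurve ℚ) [W.IsElliptic] [W.IsGloballyMinimal] (p : ℕ) [Fact p.Prime]
    (hp2 : p ≠ 2) (hsplit : W.HasSplitMultiplicativeReductionAtPrime p)
    (κ : ZpExtension ℚ p) (hκ : κ.IsCyclotomic) (γ : absoluteGaloisGroup ℚ)
    (hγ : κ.IsTopGenerator γ) (S₀ : Finset (HeightOneSpectrum (𝓞 ℚ)))
    (hS₀ : ∀ v ∈ S₀, ((p : ℕ) : 𝓞 ℚ) ∉ v.asIdeal)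
    (D : W.SelmerDualData κ γ) [Module.Finite (IwasawaAlgebra p) D.X]
    (DS : NonPrimitiveDualData W κ γ (↑S₀ : Set (HeightOneSpectrum (𝓞 ℚ))))
    (hX : D.IsTorsion) :
    Module.Finite (IwasawaAlgebra p) DS.X ∧ Module.IsTorsion (IwasawaAlgebra p) DS.X ∧
      muInvariant p DS.X = muInvariant p D.X ∧
      lambdaInvariant p DS.X = lambdaInvariant p D.X + ∑ v ∈ S₀, delta W p v := by
  obtain ⟨L, -, -, hC, htrivD, hls, hsl⟩ := exists_data_of_split W p κ hT hp2 hsplit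
  have hRD := strictKer_eq_of_le_of_le W p κ L hls hsl
  have hfix := GreenbergSelmerCountSplit.finite_fixedPoints_kerSubgroup_of_split W p κ hT hp2 hsplit hκ
  obtain ⟨hfg, hXt⟩ :=
    moduleFinite_and_isTorsion_datumDualData_empty_of_split W p κ hp2 hκ hγ L hC htrivD hRD D hX
  haveI := hfg
  -- the trivial zero: `S_A(ℚ_∞)/S^{str}_A(ℚ_∞)` is infinite (A137' at the canonical dual of `S_A`)
  haveI : Infinite (↥(gvSelmerInfty κ (W.geomPrimaryTorsion p) L ∅) ⧸
      (gvStrictSelmerInfty κ (W.geomPrimaryTorsion p) L ∅).addSubgroupOf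
        (gvSelmerInfty κ (W.geomPrimaryTorsion p) L ∅)) := by
    rw [gvSelmerInfty_eq_datumSelmerInfty, gvStrictSelmerInfty_eq_datumStrictSelmerInfty]
    exact hInf.infinite_quotient hp2 hsplit hκ hγ hC htrivD (datumDualData W κ L ∅ hγ) hXt hfix
  exact invariants_multiplicative_of_split_of_infinite W p κ h23 hp2 hκ hγ L hC htrivD hRD hfix S₀ hS₀
    D DS hX

/-- **GV (5)–(7) at an odd `p ‖ N` DERIVED (registry A133 ⇐ T-GV23L + A40 + A41 + A137').** The
tree's named fact `lambda_nonPrimitive_eq_add_sum_delta_multiplicative` — "Assuming that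
`Sel_E(ℚ_∞)_p` is `Λ`-cotorsion … `λ^{alg}_{E,Σ₀} = λ^{alg}_E + Σ_{ℓ∈Σ₀} δ_E^{(ℓ)}` (7) … it is obvious
that `μ^{alg}_E = μ^{alg}_{E,Σ₀}`" at a prime of multiplicative reduction (GV pp. 14–15, Remark
(2.10)) — follows from GV's §2 datum statements (Prop. (2.1) ⇒ Cor. (2.3) + Prop. (2.4), record
`datumSelmer_nonPrimitive_invariants`), the Tate uniformisations (Silverman V.3.1/V.5.3, V.5.4:
records A40/A41) identifying the classical local condition at `p` with Greenberg's strict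
condition for the Tate datum (tree, Greenberg p. 76), and — at a SPLIT prime, where the classical
groups are the STRICT ones — the infinitude of the trivial-zero quotient (GV p. 15 with Prop. (2.1)'s
proof p. 20, record `datumStrictSelmer_relIndex_eq_zero_of_split`); non-split primes need no trivial
zero. [cite: GreenbergVatsal2000, §1 (5)–(7) pp. 7–8; pp. 14–15; §2 Prop. (2.1) pp. 17, 20; Cor. (2.3), Prop. (2.4) (pp. 20–22); p. 26; Remark (2.10) p. 27]
[cite: SilvermanATAEC1994, Ch. V Thm. 3.1, Lemma 5.2, Thm. 5.3, Cor. 5.4]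
[cite: GreenbergLNM1716, §2 p. 76; p. 93] -/
theorem lambda_nonPrimitive_eq_add_sum_delta_multiplicative_of_datum
    (h23 : datumSelmer_nonPrimitive_invariants)
    (hT : Silverman1994_thmV53_tateUniformisation.{0})
    (hT' : Silverman1994_thmV53_corV54_tateUniformisation.{0})
    (hInf : datumStrictSelmer_relIndex_eq_zero_of_split) :
    lambda_nonPrimitive_eq_add_sum_delta_multiplicative := by
  intro W _ _ p _ hp2 hmult κ hκ γ hγ S₀ hS₀ D _ DS hX
  by_cases hsplit : W.HasSplitMultiplicativeReductionAtPrime p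
  · exact invariants_multiplicative_of_split h23 hT hInf W p hp2 hsplit κ hκ γ hγ S₀ hS₀ D DS hX
  · exact lambda_nonPrimitive_eq_add_sum_delta_multiplicative_of_not_split h23 hT' W p hp2 hmult
      hsplit κ hκ γ hγ S₀ hS₀ D DS hX

end Summit.BirchSwinnertonDyer.Rank1Residual.X2.NonPrimitiveLambdaInvariantMultiplicativeDerived

end
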